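import Mathlib
import Summits.ResolutionOfSingularities.ResolutionOfSingularities.Theorems.WeightedInvariantLocalWeightedDropWildMonicFlagNnTransport

/-!
# `WeightedInvariant.LocalWeightedDrop`, line `hasse-ridge-face-selection`, S3ρ sub-stub S3ρD `stub_wildMonicSurfaceDescent`:
# the FLAG NUMBERS `(m_𝓕, d_𝓕, n_𝓕)` of a TANGENT flag (`n_𝓕 ≥ 1`) on point sets, with the small-value conventions — definitions

Crux item stmt-ResolutionOfSingularities-8899 `LocalWeightedDrop` (route `ResolutionOfSingularities/WeightedInvariant`), engine of the
door `HypersurfaceCentreConstruction` stmt-ResolutionOfSingularities-19897.  [OURS · L1 W4.3, chain w43, res-L1-w43-stub-5 = seat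
res-D-pv-056, third seat on S3ρ under res-type-083; item (C5)-defs of stub-7's `L/res-L1-w43-stub-7/S3RHOD-ROADMAP.md` as named to this
seat 06:36:30Z; the `n_𝓕 = 0` half is stub-7's `…WildMonicFlagDefs` (`dRes`, `sValue`).  MODEL: S. Perlega, thesis Wien 2017 /
arXiv:2011.14443 §7.2 = Hauser–Perlega, Publ. RIMS 60 (2024) §8 p. 803–804, case (b) `n_𝓕 > 0`: «`ω(x) = 1, ω(y) = n_𝓕`;
`m_{𝓕,x} = ω(J_{2,x})`, `d_{𝓕,x} = ord_{(y)} wk-in_ω(J_{2,x})`; `m_𝓕 = m_{𝓕,x}` if `m_{𝓕,x} ≥ n_𝓕·c!`, else `n_𝓕·c!`; `d_𝓕 = d_{𝓕,x}` if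
`d_{𝓕,x} ≥ c!`, `= d_{𝓕,x}` if `0 < d_{𝓕,x} < c!` and `c! ∤ m_𝓕`, `= 0` if `0 < d_{𝓕,x} < c!` and `c! ∣ m_𝓕`, `= 0` if `d_{𝓕,x} = 0`;
`s_𝓕 = 0`» and §5 p. 783–784 (i)/(ii) for `n_𝓕` itself.  Nothing here is a statement of H. Hironaka's manuscript [claim: Hironaka2017,
status: under-review]; nothing is asserted about Perlega's text — OUR definitions, read on the `d!`-scaled Newton set `N` of the tuple in
the flag's subordinate coordinates (the curve `F₁` is the `x₁`-axis `V(y, x₂)`; `P₀` = exponent of `x₁`, `P₁` = exponent of `x₂`).]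

* `wOrdN n N` — `m_{𝓕,x}`: the `(1, n)`-weighted order `min_{P ∈ N} (P₀ + n·P₁)` (on the `d!`-scale);
* `initHeight n N` — `d_{𝓕,x}`: the least height `P₁` over the `(1,n)`-INITIAL LINE `{P ∈ N : P₀ + n·P₁ = wOrdN n N}` (the `x₂`-order of
  the weak initial ideal);
* `mFlagN L n N`, `dFlagN L n N` — `m_𝓕`, `d_𝓕` with the conventions above at scale `L` (`= c! = d!` for the game's positions; Hauser–Perlega's
  `0` is used where Perlega prints `−1`);
* `tangency E hzero r` — `n_𝓕` of a TRIANGULAR flag datum `F₁ = V(y, x₂ + h(x₁))` from the boundary letters `E ⊆ {0, 1}` (`0 = V(x₁)`,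
  `1 = V(x₂)`), `hzero = (h = 0)` and `r = ord h`: `0` if `h = 0` (the curve IS the axis), else `1` if `r = 1` and both letters are boundary
  (three transversal curves), else `r` if `r ≥ 2` and the letter `1` is boundary (tangency to `V(x₂)` of order `r`), else `0`
  (Hauser–Perlega §5 (i)/(ii); Perlega Lemma 6.6.1);
* unfoldings, `wOrdN_one_eq_deltaL` / `initHeight_one_eq_gammaL` (for `n = 1` these are lead-1's `deltaL` / `gammaL`), attainment lemmas, and
  the TRANSPORT of all four numbers under the monomial point step `psi L` in these words (from `…WildMonicFlagNnTransport`):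
  `wOrdN_image_psi_add`, `initHeight_image_psi`, `mFlagN_image_psi_add`, `dFlagN_image_psi` — Perlega Prop. 9.1.1, `n_𝓕 > 1`:
  «`n_{𝓕′} = n_𝓕 − 1`, `d_{𝓕′} = d_𝓕`», conventions included.
The flag FAMILY as a type, its cleaning, the maximisation over it (Per17 Props 7.4.8–7.4.11) and the measure `μ` are D-0 (not here).
AI-written; gate-accepted means sorry-free with standard axioms, not refereed.
-/

set_option linter.dupNamespace false -- mandated namespace of this single-conjunct summit

noncomputable section

namespace Summit.ResolutionOfSingularities.ResolutionOfSingularities.Theorems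

namespace WildMonic

open MonicDescent

variable {N : Set (Fin 2 →₀ ℕ)} {L n : ℕ}

/-! ## Definitions -/

/-- `m_{𝓕,x}` ON THE `d!`-SCALE: the `(1, n)`-weighted order of a point set, `min_{P ∈ N} (P₀ + n·P₁)` (`0` for the empty set). -/
def wOrdN (n : ℕ) (N : Set (Fin 2 →₀ ℕ)) : ℕ := sInf ((fun P : Fin 2 →₀ ℕ => P 0 + n * P 1) '' N)

/-- `d_{𝓕,x}` ON THE `d!`-SCALE: the least height `P₁` over the `(1,n)`-initial line of `N` — the `x₂`-order of the weak `(1,n)`-initial ideal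
(`0` if the initial line is empty, which only happens for `N = ∅`). -/
def initHeight (n : ℕ) (N : Set (Fin 2 →₀ ℕ)) : ℕ :=
  sInf ((fun P : Fin 2 →₀ ℕ => P 1) '' {P | P ∈ N ∧ P 0 + n * P 1 = wOrdN n N})

/-- `m_𝓕` at scale `L` for a tangent flag of tangency `n`: `m_{𝓕,x}` if `m_{𝓕,x} ≥ n·L`, else `n·L` (HP p. 804). -/
def mFlagN (L n : ℕ) (N : Set (Fin 2 →₀ ℕ)) : ℕ := if n * L ≤ wOrdN n N then wOrdN n N else n * L

/-- `d_𝓕` at scale `L` for a tangent flag of tangency `n` (HP p. 804 (b), `0` where Perlega prints `−1`): `d_{𝓕,x}` if `d_{𝓕,x} ≥ L`; `d_{𝓕,x}`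
if `0 < d_{𝓕,x} < L` and `L ∤ m_𝓕`; `0` otherwise. -/
def dFlagN (L n : ℕ) (N : Set (Fin 2 →₀ ℕ)) : ℕ :=
  if L ≤ initHeight n N then initHeight n N
  else if 0 < initHeight n N ∧ ¬ L ∣ mFlagN L n N then initHeight n N else 0

/-- `n_𝓕` OF A TRIANGULAR FLAG DATUM `F₁ = V(y, x₂ + h(x₁))` from the boundary letters `E` (`0 = V(x₁)`, `1 = V(x₂)`), the vanishing of `h`
and `r = ord h`: `0` if `h = 0`; else `1` if `r = 1` and `E = {0, 1}`; else `r` if `2 ≤ r` and `1 ∈ E`; else `0` (HP §5 (i)/(ii)). -/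
def tangency (E : Finset (Fin 2)) (hzero : Bool) (r : ℕ) : ℕ :=
  if hzero then 0
  else if r = 1 then (if (0 : Fin 2) ∈ E ∧ (1 : Fin 2) ∈ E then 1 else 0)
  else if (1 : Fin 2) ∈ E then r else 0

/-! ## Unfoldings and attainment -/

/-- Unfolding of `wOrdN`. -/
theorem wOrdN_def (n : ℕ) (N : Set (Fin 2 →₀ ℕ)) : wOrdN n N = sInf ((fun P : Fin 2 →₀ ℕ => P 0 + n * P 1) '' N) := rfl

/-- Unfolding of `initHeight`. -/
theorem initHeight_def (n : ℕ) (N : Set (Fin 2 →₀ ℕ)) :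
    initHeight n N = sInf ((fun P : Fin 2 →₀ ℕ => P 1) '' {P | P ∈ N ∧ P 0 + n * P 1 = wOrdN n N}) := rfl

/-- The weighted order is attained. -/
theorem exists_eq_wOrdN (n : ℕ) (hN : N.Nonempty) : ∃ P ∈ N, P 0 + n * P 1 = wOrdN n N := by
  obtain ⟨P, hP, hPw⟩ := Nat.sInf_mem (hN.image (fun P : Fin 2 →₀ ℕ => P 0 + n * P 1))
  exact ⟨P, hP, hPw⟩

/-- The weighted order is a lower bound. -/
theorem wOrdN_le (n : ℕ) {P : Fin 2 →₀ ℕ} (hP : P ∈ N) : wOrdN n N ≤ P 0 + n * P 1 := Nat.sInf_le ⟨P, hP, rfl⟩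

/-- The initial height is attained on the initial line. -/
theorem exists_eq_initHeight (n : ℕ) (hN : N.Nonempty) :
    ∃ P ∈ N, P 0 + n * P 1 = wOrdN n N ∧ P 1 = initHeight n N := by
  have hI : ((fun P : Fin 2 →₀ ℕ => P 1) '' {P | P ∈ N ∧ P 0 + n * P 1 = wOrdN n N}).Nonempty := by
    obtain ⟨P, hP, hPw⟩ := exists_eq_wOrdN n hN
    exact ⟨P 1, P, ⟨hP, hPw⟩, rfl⟩
  obtain ⟨P, ⟨hP, hPw⟩, hPh⟩ := Nat.sInf_mem hI
  exact ⟨P, hP, hPw, hPh⟩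

/-- The initial height is a lower bound on the initial line. -/
theorem initHeight_le (n : ℕ) {P : Fin 2 →₀ ℕ} (hP : P ∈ N) (hPw : P 0 + n * P 1 = wOrdN n N) : initHeight n N ≤ P 1 :=
  Nat.sInf_le ⟨P, ⟨hP, hPw⟩, rfl⟩

/-- For `n = 1` the weighted order is lead-1's `deltaL`. -/
theorem wOrdN_one_eq_deltaL (N : Set (Fin 2 →₀ ℕ)) : wOrdN 1 N = deltaL N := by
  simp only [wOrdN, deltaL, one_mul]

/-- For `n = 1` the initial height is lead-1's `gammaL` (least height on the `δ`-face). -/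
theorem initHeight_one_eq_gammaL (N : Set (Fin 2 →₀ ℕ)) : initHeight 1 N = gammaL N := by
  simp only [initHeight, gammaL, wOrdN_one_eq_deltaL, one_mul]

/-- Unfolding of `mFlagN` when the weighted order is large. -/
theorem mFlagN_of_le (h : n * L ≤ wOrdN n N) : mFlagN L n N = wOrdN n N := by simp [mFlagN, h]

/-- Unfolding of `mFlagN` when the weighted order is small. -/
theorem mFlagN_of_lt (h : wOrdN n N < n * L) : mFlagN L n N = n * L := by simp [mFlagN, not_le.mpr h]

/-- `m_𝓕 ≥ n·L` always. -/
theorem le_mFlagN (L n : ℕ) (N : Set (Fin 2 →₀ ℕ)) : n * L ≤ mFlagN L n N := by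
  unfold mFlagN; split_ifs with h
  · exact h
  · exact le_rfl

/-- Unfolding of `dFlagN`: the large case. -/
theorem dFlagN_of_le (h : L ≤ initHeight n N) : dFlagN L n N = initHeight n N := by simp [dFlagN, h]

/-- Unfolding of `dFlagN`: the middle case. -/
theorem dFlagN_of_lt_of_not_dvd (h : initHeight n N < L) (h0 : 0 < initHeight n N) (hndvd : ¬ L ∣ mFlagN L n N) :
    dFlagN L n N = initHeight n N := by simp [dFlagN, not_le.mpr h, h0, hndvd]

/-- Unfolding of `dFlagN`: the divisible small case (Perlega's `−1`). -/
theorem dFlagN_of_lt_of_dvd (h : initHeight n N < L) (hdvd : L ∣ mFlagN L n N) : dFlagN L n N = 0 := by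
  simp [dFlagN, not_le.mpr h, hdvd]

/-- Unfolding of `dFlagN`: the zero case. -/
theorem dFlagN_of_eq_zero (hL : 0 < L) (h0 : initHeight n N = 0) : dFlagN L n N = 0 := by
  simp [dFlagN, h0, Nat.pos_iff_ne_zero.mp hL]

/-- `d_𝓕 ≤ d_{𝓕,x}`. -/
theorem dFlagN_le_initHeight (L n : ℕ) (N : Set (Fin 2 →₀ ℕ)) : dFlagN L n N ≤ initHeight n N := by
  unfold dFlagN; split_ifs <;> omega

/-- `d_𝓕` is `d_{𝓕,x}` or `0`. -/
theorem dFlagN_eq_or (L n : ℕ) (N : Set (Fin 2 →₀ ℕ)) : dFlagN L n N = initHeight n N ∨ dFlagN L n N = 0 := by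
  unfold dFlagN; split_ifs <;> simp

/-- Unfoldings of `tangency`. -/
theorem tangency_of_zero (E : Finset (Fin 2)) (r : ℕ) : tangency E true r = 0 := by simp [tangency]

/-- `n_𝓕 = 1`: both letters boundary, `ord h = 1` (three pairwise transversal curves). -/
theorem tangency_one_both (r : ℕ) (hr : r = 1) : tangency {0, 1} false r = 1 := by subst hr; simp [tangency]

/-- `n_𝓕 = ord h ≥ 2`: the curve touches the boundary component `V(x₂)` to order `ord h`. -/
theorem tangency_of_two_le {E : Finset (Fin 2)} {r : ℕ} (hr : 2 ≤ r) (h1 : (1 : Fin 2) ∈ E) : tangency E false r = r := by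
  have : r ≠ 1 := by omega
  simp [tangency, this, h1]

/-- `n_𝓕 = 0` when `V(x₂)` is not a boundary component (the curve is transversal to `V(x₁)`). -/
theorem tangency_of_not_mem {E : Finset (Fin 2)} (r : ℕ) (h1 : (1 : Fin 2) ∉ E) : tangency E false r = 0 := by
  unfold tangency
  simp only [Bool.false_eq_true, ↓reduceIte]
  split_ifs with hr h01
  · exact absurd h01.2 h1
  · rfl
  · rfl

/-! ## Transport under the monomial point step (Perlega Prop. 9.1.1, `n_𝓕 > 1`: `n ↦ n − 1`, `m ↦ m − L`, `d_{𝓕,x}` and `d_𝓕` kept) -/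

/-- `m_{𝓕′,x′} + L = m_{𝓕,x}` (weights `(1, n)` after, `(1, n+1)` before). -/
theorem wOrdN_image_psi_add (n : ℕ) (hN : N.Nonempty) (hL : ∀ P ∈ N, L ≤ P 0 + P 1) :
    wOrdN n (psi L '' N) + L = wOrdN (n + 1) N :=
  wOrd_image_psi_add n hN hL

/-- `d_{𝓕′,x′} = d_{𝓕,x}`. -/
theorem initHeight_image_psi (n : ℕ) (hN : N.Nonempty) (hL : ∀ P ∈ N, L ≤ P 0 + P 1) :
    initHeight n (psi L '' N) = initHeight (n + 1) N := by
  obtain ⟨P, hP, hPw, hPh⟩ := exists_eq_initHeight (n + 1) hN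
  have hPmin : ∀ R ∈ N, R 0 + (n + 1) * R 1 = wOrdN (n + 1) N → P 1 ≤ R 1 :=
    fun R hR hRw => hPh ▸ initHeight_le (n + 1) hR hRw
  obtain ⟨hmem, hQw, hQ1, hQmin⟩ := initialMin_image_psi n hN hL hP hPw hPmin
  rw [← hPh]
  apply le_antisymm
  · calc initHeight n (psi L '' N) ≤ psi L P 1 := initHeight_le n hmem hQw
      _ = P 1 := hQ1
  · obtain ⟨Q, hQ, hQw', hQh⟩ := exists_eq_initHeight n (hN.image (psi L))
    rw [← hQh]
    exact hQmin Q hQ hQw'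

/-- `m_{𝓕′} + L = m_𝓕` (the convention `max(m_x, n·L)` commutes with the step: `m_x ≥ (n+1) L ↔ m_x − L ≥ n L`). -/
theorem mFlagN_image_psi_add (n : ℕ) (hN : N.Nonempty) (hL : ∀ P ∈ N, L ≤ P 0 + P 1) :
    mFlagN L n (psi L '' N) + L = mFlagN L (n + 1) N := by
  have h := wOrdN_image_psi_add n hN hL
  unfold mFlagN
  split_ifs with h1 h2 h2 <;> [omega; (exfalso; apply h2; nlinarith [h1, h]); (exfalso; apply h1; nlinarith [h2, h]); ring]

/-- `d_{𝓕′} = d_𝓕` for the induced flag of tangency `n ≥ 1` from a flag of tangency `n + 1` (Perlega Prop. 9.1.1, bullet `n_𝓕 > 1`), the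
small-value conventions included (`L ∣ m_𝓕 ↔ L ∣ m_{𝓕′}` since they differ by `L`). -/
theorem dFlagN_image_psi (n : ℕ) (hN : N.Nonempty) (hL : ∀ P ∈ N, L ≤ P 0 + P 1) :
    dFlagN L n (psi L '' N) = dFlagN L (n + 1) N := by
  have hh := initHeight_image_psi n hN hL
  have hm := mFlagN_image_psi_add n hN hL
  have hdvd : L ∣ mFlagN L n (psi L '' N) ↔ L ∣ mFlagN L (n + 1) N := by
    rw [← hm]
    exact ⟨fun h => dvd_add h (dvd_refl L), fun h => (Nat.dvd_add_right (dvd_refl L)).mp (by rwa [add_comm] at h)⟩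
  unfold dFlagN
  rw [hh]
  by_cases h1 : L ≤ initHeight (n + 1) N
  · simp [h1]
  · simp [h1, hdvd]

end WildMonic

end Summit.ResolutionOfSingularities.ResolutionOfSingularities.Theorems

end
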